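import Literature.MathematicalPhysics.QuantumFieldTheory.Balaban1983to89.B8Eq1101DentedCubeMemberRegionA4
import Literature.MathematicalPhysics.QuantumFieldTheory.Balaban1983to89.B8Eq1101DentedCubeMemberRealGrad

/-!
# `Balaban1983to89.B8Eq1101DentedCubeMemberRealM4` — [Balaban1985RegularSpaces] (1.101) ∕ [Balaban1985BackgroundPropagators] (3.47) AT `γ = −4` ON THE DENTED CUBE
# MEMBER `{Ω′_j}` OF [Balaban1985Variational] (148)–(150): `(Lʲη)²|T⁻¹u| ≤ B_G′·sup (Lʲη)⁴|u|` — the hypothesis REAL-1′ of the (β) crown in its general-weights shape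
# (dented twin of dag-n05-c's F4e `B8Eq1101CubeMemberRealM4` §4)

statement-level skeleton of published theorems with citation tags; proofs where landed; nothing here is a claim about the Yang–Mills mass gap

`[Balaban1985RegularSpaces]` ("B8" = [6], CMP **99** (1985) 75–102) (1.101) p. 93, (1.91)–(1.92) p. 91, p. 98, (1.131) p. 99; `[Balaban1985BackgroundPropagators]` ([4], CMP **99**
(1985) 389–434) Theorem 3.1 (3.47) p. 398 («for γ ∈ [−4, 4]»); `[Balaban1984PropagatorsII]` ("B6", CMP **96** (1984) 223–250) (2.47)–(2.58) p. 231–233, Prop. 2.2 (2.67) p. 234;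
`[Balaban1985Variational]` ("[15]", CMP **102** (1985) 277–309) (148)–(151) p. 301.  PDFs held (`paper:balaban1985-cmp99-…`, `…-cmp102-…`, `…-cmp96-…`).
CITATION HEADER (lean-in-tree rule).  Cell `pub-ymgap` (D-0062), node N05 = [B8], seat `pub-ymgap-dag-n05-e` (g32; row s3b; (d2-f) the dented parametrix, file 7; g31 HANDOFF
«Next 1 (iii)», dag-n05-c STANDING GO I.42366, INTENT I.43617).  WHY: the named fact `Real1M4DentedCubeMemberPrinted` (p669491) is this theorem at the printed weights (next
file).  WHAT (kernel-checked): ★★★ `ineq1101_dentedCubeMember_m4 (d ℓ) (hℓ : 1 ≤ ℓ)` — F4e's §4 proof token for token at the dented L0 box member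
`(cubeTDomainsDented … (boxP …) …).toDomains` (r05's L0 general-exponent reading `B8Ineq198MultiLevelBoxL0.ineq1101_multiLevelBox … 4` for region A; files 1–3 and 6 of this
unit for the parametrix pieces; weight windows at every level).  HONEST SCOPE: the estimates are p21∕r05's and F3's; this file is the transfer; count-neutral; N05 ∕ N07 NOT
discharged; one finite `T⁴` programme at fixed `ε`, Bałaban as printed; nothing continuum ∕ ℝ⁴ ∕ OS ∕ mass-gap ∕ Clay.  No `sorry`∕`def`∕`instance`∕`notation`;
`maxHeartbeats 400000` on the one theorem as in the pure twin.  RELATED, NOT DUPLICATED (`rg -l 'Eq1101DentedCubeMemberRealM4'` = 0, 2026-08-28T23:10Z): F4e (dag-n05-c;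
the PURE twin), files 1–6 of this unit (g32), r05 `B8Ineq198MultiLevelBoxL0`, F4c∕F4b structure-free lemmas (USED).  Unit `pub-ymgap-dag-n05-e` (g32), 2026-08-28.
-/
noncomputable section

namespace Literature.MathematicalPhysics.QuantumFieldTheory.Balaban1983to89.B8Eq1101DentedCubeMemberRealM4

open scoped Matrix
open B6MultiLevelBoxOperator (N0 mlOp gml levC)
open B6Prop22DerivMultiLevelBox (dMat)
open B6Ineq243TwoLevelBox (aNext)
open B4Reflection242 (boxDom mem_boxDom blk)
open B7Prop1Explicit (e)
open B8Eq131Cubes (l1dist cube cube_anti)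
open B8Eq191FlatDirichletDepth (depth depth_ge_of_mem_inner)
open B8LambdaSpaceKLevel (wt)
open B8Eq191FlatDirichletForm (isUnit_flatMatrix)
open B8CubeMemberBoxDomains (shift boxP)
open B8CubeMemberTorusDomainsDented (cubeTDomainsDented levD levD_le le_levD_iff hΩ_of_anchored)
open B8Eq191FlatLettersDentedCubeMember (sq_subset_zero)
open B8Ineq198MultiLevelBoxL0 (ineq1101_multiLevelBox)
open B8Eq1101CubeMemberCutoffs (cutA cutAt cutB cutBt cut_mem cutAt_eq_of_depth cutBt_facts wall wall_subset)
open B8Eq1101DentedCubeMemberParametrixIdentity (parametrix_identity regionB_bound)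
open B8Eq1101DentedCubeMemberCommutator (commutator_bound)
open B8Eq1101DentedCubeMemberRegionA4 (regionA_bounds4 commutator_vanish_deep)
open B8Eq1101CubeMemberReal (apriori_functional_bound dite_shift_apply)
open Node00 (CubeB8D)
open Literature.MathematicalPhysics.QuantumLattice (blockMap)

variable {d : ℕ}

set_option maxHeartbeats 400000 in
open Classical in
/-- **[Balaban1985RegularSpaces] (1.101) AT `U₀ = 1` ON THE DENTED CUBE MEMBER `{Ω′_j}` OF [Balaban1985Variational] (148)–(150), EXPONENT `−4 → −2` — THE HYPOTHESIS REAL-1′ OF THE (β) CROWN (`Real1M4DentedCubeMemberPrinted` at the printed weights)** (dag-n05-c's F4e `ineq1101_cubeMember_m4` token for token at the dented L0 box member; weight windows at every level, as r05's L0 reading wants)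
([4] (3.47) «|G′(U)λ|₍₂₊γ₎ ≦ B₀|λ|₍γ₎ … for γ ∈ [−4, 4]» at `γ = −4`, function member).  Same data regime and weight hypotheses as F4c∕F4d
(`B8Eq1101CubeMemberReal.ineq1101_cubeMember_sup`; the collar threshold `ρ₀` is larger: the smallness of the commutator in the `(−4)`-weighted norm costs a
factor `L²`).  For every source `u` on `□₀` with `(Lʲη)⁴|u| ≤ r` on `□_j` (`j ≤ n`): `(Lʲη)²|(T⁻¹u)(v)| ≤ B_G′·r` for `v ∈ □_j`.  PROOF: the two-region parametrix
`T·P = 1 + K₁` of F4b; region A at exponent 4 (§2, r05's general-exponent (1.101)); the wall at exponent 2 with `N ↦ Nη⁻²` (levels `≤ 1`); `K₁u` VANISHES on `□₂`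
(§3) and is `≤ 10(d+1)L⁴(C′ + C_W)∕s`-small in the `(−4)`-norm at levels `≤ 1`; a-priori inversion (F4c §1) of the weighted functional `u ↦ (Lʲη)²(T⁻¹u)(v)`.
[cite: Balaban1985RegularSpaces, (1.101) p.93, p.98, (1.131) p.99; Balaban1985BackgroundPropagators, Theorem 3.1 (3.47) p.398; Balaban1984PropagatorsII, (2.47)–(2.58) p.231–233, Prop. 2.2 (2.67) p.234] -/
theorem ineq1101_dentedCubeMember_m4 (d ℓ : ℕ) (hℓ : 1 ≤ ℓ) :
    ∃ BG ρ₀ M₀ : ℝ, ∃ N₀ : ℕ, 0 < BG ∧ 0 < M₀ ∧ 0 < N₀ ∧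
      ∀ (η : ℝ), 0 < η → ∀ (Mh : ℕ), 3 ≤ Mh → M₀ ≤ ((ℓ : ℝ) + 1) * Mh →
      ∀ (K' : ℕ) (Ω : ℕ → Set (Fin (d + 1) → ℤ)) (c : CubeB8D (d + 1) (ℓ + 1) K' Ω) (R : ℕ),
        Mh * (ℓ + 1) ∣ c.ρ → Mh * (ℓ + 1) ∣ c.M → R * (Mh * (ℓ + 1)) ≤ c.ρ → 2 * (ℓ + 1) ≤ R → N₀ + 1 ≤ R * ((ℓ + 1) * Mh) → ρ₀ ≤ (c.ρ : ℝ) →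
        (∀ x y : Fin (d + 1) → ℤ,
            blockMap (Mh * (ℓ + 1) ^ (c.k + 1)) (x - fun i => (((ℓ + 1 : ℕ) : ℤ)) ^ c.k * (c.a i - c.ρ)) =
              blockMap (Mh * (ℓ + 1) ^ (c.k + 1)) (y - fun i => (((ℓ + 1 : ℕ) : ℤ)) ^ c.k * (c.a i - c.ρ)) → x ∈ Ω c.k → y ∈ Ω c.k) →
      ∀ (aw cw : ℕ → ℝ), (∀ i, 4 ≤ aw i ∧ aw i ≤ 8) → (∀ i, 8 ≤ cw i ∧ cw i ≤ 32 / 3) →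
        (∀ i, aw (i + 1) = aNext ℓ (aw i) (cw i)) → (∀ j, 0 < aw j) →
      ∀ (w : ℕ → ℝ), (∀ j, 0 < w j) →
        (∀ j, j ≤ c.k → w j * (((((ℓ + 1 : ℕ) : ℝ) ^ (d + 1))⁻¹) ^ j) ^ 2 = (η ^ 2)⁻¹ * levC d ℓ aw j) →
        (∀ j, j ≤ c.k → 4 ≤ w j * η ^ 2 * (((ℓ + 1 : ℕ) : ℝ) ^ j) ^ 2 * (((((ℓ + 1 : ℕ) : ℝ)) ^ (d + 1)) ^ j)⁻¹ ∧
          w j * η ^ 2 * (((ℓ + 1 : ℕ) : ℝ) ^ j) ^ 2 * (((((ℓ + 1 : ℕ) : ℝ)) ^ (d + 1)) ^ j)⁻¹ ≤ 8) →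
      ∀ (S : Finset (Fin (d + 1) → ℤ)), (∀ z, z ∈ S ↔ z ∈ c.sq 0) →
      ∀ (K : (Fin (d + 1) → ℤ) → (Fin (d + 1) → ℤ) → ℝ), (∀ x z, K x z =
          ((η ^ 2)⁻¹ * ∑ μ : Fin (d + 1), ((2 : ℝ) * (if z = x then (1 : ℝ) else 0) - (if z = x + e μ then (1 : ℝ) else 0)
            - (if z = x - e μ then (1 : ℝ) else 0))) +
          (∑ j ∈ Finset.range (c.k + 1), (if blockMap ((ℓ + 1) ^ j) x ∈ c.lamS j ∧
              blockMap ((ℓ + 1) ^ j) z = blockMap ((ℓ + 1) ^ j) x then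
            w j * (((((ℓ + 1 : ℕ) : ℝ) ^ (d + 1))⁻¹) ^ j) ^ 2 else 0))) →
      ∀ (T : Matrix ↥S ↥S ℝ), T = Matrix.of (fun x z : ↥S => K x.1 z.1) →
      ∀ (u : ↥S → ℝ) (r : ℝ), 0 ≤ r →
        (∀ j, j ≤ c.k → ∀ z : ↥S, z.1 ∈ c.sq j → wt (ℓ + 1) η j ^ 4 * |u z| ≤ r) →
        ∀ j, j ≤ c.k → ∀ v : ↥S, v.1 ∈ c.sq j →
          wt (ℓ + 1) η j ^ 2 * |∑ z : ↥S, T⁻¹ v z * u z| ≤ BG * r := by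
  have hd : 0 < d + 1 := Nat.succ_pos d
  have hL : 1 ≤ ℓ + 1 := Nat.succ_pos ℓ
  have hLr : (1 : ℝ) ≤ ((ℓ + 1 : ℕ) : ℝ) := by exact_mod_cast hL
  have hLpos : (0 : ℝ) < ((ℓ + 1 : ℕ) : ℝ) := by positivity
  have hcast : ((ℓ + 1 : ℕ) : ℝ) = (ℓ : ℝ) + 1 := by push_cast; ring
  -- region A's (1.101) package at exponent 4 (p21 ∕ r05 via §1), weight windows `[4, 8]`
  obtain ⟨C', M₀, N₀, hC', hM₀, hN₀, hregA⟩ := ineq1101_multiLevelBox d ℓ hℓ 4 8 8 (32 / 3) (by norm_num) (by norm_num) 4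
  -- the wall constant (F3 at `a₀ = 4`, `θ = ½`, `δ′ = 1/(2(d+1))`)
  set CW : ℝ := (((ℓ + 1 : ℕ) : ℝ)) ^ 2 / (4 * (1 - 1 / 2)) * B6.c0 1 (1 / (2 * ((d : ℝ) + 1)) / ((ℓ + 1 : ℕ) : ℝ)) ^ (d + 1) with hCW
  have hc0 : 1 ≤ B6.c0 1 (1 / (2 * ((d : ℝ) + 1)) / ((ℓ + 1 : ℕ) : ℝ)) := B8Eq191FlatDirichletWall.one_le_c0 (by positivity)
  have hCW0 : 0 ≤ CW := by rw [hCW]; have := hc0; positivity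
  -- the ramp-length threshold (a factor `L²` larger than at exponent 2) and the collar threshold
  set s₀ : ℝ := 20 * ((d : ℝ) + 1) * (((ℓ + 1 : ℕ) : ℝ)) ^ 4 * (C' + CW) with hs₀
  have hs₀0 : 0 ≤ s₀ := by rw [hs₀]; positivity
  set ρ₀ : ℝ := 4 * s₀ + 12 + ((d : ℝ) + 1) * ℓ with hρ₀
  refine ⟨2 * (C' + (((ℓ + 1 : ℕ) : ℝ)) ^ 2 * CW), ρ₀, M₀, N₀, by positivity, hM₀, hN₀, ?_⟩
  intro η hη Mh hMh hM0 K' Ω c R hρd hMd hR hR2 hRN hρbig hanch aw cw haw hc hrec hawpos w hwpos hw hwin S hS K hK T hT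
    u₁ r hr hu₁ j₀ hj₀ v hv
  have hη0 : η ≠ 0 := hη.ne'
  have hη2 : 0 < η ^ 2 := by positivity
  have hMh1 : 1 ≤ Mh := le_trans (by norm_num) hMh
  have hMh2 : 2 ≤ Mh := le_trans (by norm_num) hMh
  have hk : 1 ≤ c.k := c.one_le_k
  have hρL : ℓ + 1 ≤ c.ρ := c.L_le_ρ
  have hρ0 : 0 < c.ρ := lt_of_lt_of_le (Nat.succ_pos ℓ) hρL
  have hΩc := hΩ_of_anchored (Mh := Mh) hMh1 c (fun x x' hxx => hanch x x' (by simpa only [B6MultiLevelBoxOperator.bigSide] using hxx))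
  set DL := (cubeTDomainsDented hℓ hMh2 c hρd hMd hR (boxP ℓ c.M c.ρ c.k c.k) (fun _ => le_rfl) hΩc).toDomains with hDL
  have hlevDL : DL.lev = levD Mh c := rfl
  have hPbox : ∀ μ' : Fin (d + 1), 1 ≤ boxP (d := d) ℓ c.M c.ρ c.k c.k μ' := fun μ' => le_trans hρ0 (Nat.le_add_right _ _)
  -- the ramp length `s` and the wall parameter `m_W = 4s`
  obtain ⟨s, hs⟩ : ∃ s : ℕ, s = (c.ρ * (ℓ + 1) - (d + 1) * ℓ) / 4 := ⟨_, rfl⟩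
  have hρL' : (d + 1) * ℓ + 4 * (Nat.ceil s₀ + 1) ≤ c.ρ * (ℓ + 1) := by
    have h1 : (c.ρ : ℝ) ≤ (c.ρ : ℝ) * ((ℓ + 1 : ℕ) : ℝ) := le_mul_of_one_le_right (by positivity) hLr
    have h2 : ((Nat.ceil s₀ : ℕ) : ℝ) < s₀ + 1 := Nat.ceil_lt_add_one hs₀0
    have h3 : (((d + 1) * ℓ + 4 * (Nat.ceil s₀ + 1) : ℕ) : ℝ) ≤ ((c.ρ * (ℓ + 1) : ℕ) : ℝ) := by
      push_cast; rw [hρ₀] at hρbig; push_cast at h1; nlinarith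
    exact_mod_cast h3
  have hs_ge : Nat.ceil s₀ + 1 ≤ s := by
    rw [hs, Nat.le_div_iff_mul_le (by norm_num)]; omega
  have hs1 : 1 ≤ s := le_trans (by omega) hs_ge
  have hss₀ : s₀ ≤ s := (Nat.le_ceil s₀).trans (by exact_mod_cast (by omega : Nat.ceil s₀ ≤ s))
  have hs4 : 4 * s + (d + 1) * ℓ ≤ c.ρ * (ℓ + 1) := by
    rw [hs]; have := Nat.div_mul_le_self (c.ρ * (ℓ + 1) - (d + 1) * ℓ) 4; omega
  have hmWρ : ((4 * s : ℕ) : ℤ) + (d + 1 : ℕ) * ((ℓ + 1 : ℕ) - 1 : ℤ) ≤ c.ρ * (ℓ + 1 : ℕ) := by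
    have : (((4 * s + (d + 1) * ℓ : ℕ)) : ℤ) ≤ ((c.ρ * (ℓ + 1) : ℕ) : ℤ) := by exact_mod_cast hs4
    push_cast at this ⊢; linarith
  have hρs : 4 * (s : ℤ) ≤ c.ρ * (ℓ + 1 : ℕ) := by
    have : (((4 * s : ℕ)) : ℤ) ≤ ((c.ρ * (ℓ + 1) : ℕ) : ℤ) := by exact_mod_cast (le_trans (Nat.le_add_right _ _) hs4)
    push_cast at this ⊢; linarith
  have hs0r : (0 : ℝ) < s := by exact_mod_cast hs1
  -- the `(−4)`-size predicate and the explicit operators of the parametrix, as functions of the source `u`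
  obtain ⟨BW, hBW⟩ : ∃ BW : ((Fin (d + 1) → ℤ) → ℝ) → ℝ → Prop,
      ∀ u N, BW u N ↔ ∀ j, j ≤ c.k → ∀ z, z ∈ c.sq j → ((((ℓ + 1 : ℕ) : ℝ)) ^ j * η) ^ 4 * |u z| ≤ N :=
    ⟨fun u N => ∀ j, j ≤ c.k → ∀ z, z ∈ c.sq j → ((((ℓ + 1 : ℕ) : ℝ)) ^ j * η) ^ 4 * |u z| ≤ N, fun _ _ => Iff.rfl⟩
  obtain ⟨uAf, huAf⟩ : ∃ uAf : ((Fin (d + 1) → ℤ) → ℝ) → ↥(boxDom (N0 ℓ Mh c.k (boxP ℓ c.M c.ρ c.k c.k))) → ℝ,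
      ∀ u y, uAf u y = cutA hd (ℓ + 1) c.a c.M c.ρ c.k s (y.1 - shift ℓ Mh c.a c.ρ c.k c.k) * u (y.1 - shift ℓ Mh c.a c.ρ c.k c.k) := ⟨_, fun _ _ => rfl⟩
  obtain ⟨gAxf, hgAxf⟩ : ∃ gAxf : ((Fin (d + 1) → ℤ) → ℝ) → (Fin (d + 1) → ℤ) → ℝ,
      ∀ u z, gAxf u z = if h : z + shift ℓ Mh c.a c.ρ c.k c.k ∈ boxDom (N0 ℓ Mh c.k (boxP ℓ c.M c.ρ c.k c.k)) then
        (gml (N0 ℓ Mh c.k (boxP ℓ c.M c.ρ c.k c.k)) ℓ c.k (levD Mh c) aw *ᵥ uAf u) ⟨z + shift ℓ Mh c.a c.ρ c.k c.k, h⟩ else 0 := ⟨_, fun _ _ => rfl⟩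
  obtain ⟨uBf, huBf⟩ : ∃ uBf : ((Fin (d + 1) → ℤ) → ℝ) → ↥(wall hd (ℓ + 1) c.a c.M c.ρ c.k S (4 * s)) → ℝ,
      ∀ u y, uBf u y = cutB hd (ℓ + 1) c.a c.M c.ρ c.k s y.1 * u y.1 := ⟨_, fun _ _ => rfl⟩
  obtain ⟨gBxf, hgBxf⟩ : ∃ gBxf : ((Fin (d + 1) → ℤ) → ℝ) → (Fin (d + 1) → ℤ) → ℝ,
      ∀ u z, gBxf u z = if h : z ∈ wall hd (ℓ + 1) c.a c.M c.ρ c.k S (4 * s) then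
        (((Matrix.of fun x z : ↥(wall hd (ℓ + 1) c.a c.M c.ρ c.k S (4 * s)) => K x.1 z.1)⁻¹) *ᵥ uBf u) ⟨z, h⟩ else 0 := ⟨_, fun _ _ => rfl⟩
  obtain ⟨Pf, hPf⟩ : ∃ Pf : ((Fin (d + 1) → ℤ) → ℝ) → (Fin (d + 1) → ℤ) → ℝ,
      ∀ u z, Pf u z = cutAt hd (ℓ + 1) c.a c.M c.ρ c.k s z * (η ^ 2 * gAxf u z) + cutBt hd (ℓ + 1) c.a c.M c.ρ c.k s z * gBxf u z := ⟨_, fun _ _ => rfl⟩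
  obtain ⟨K₁, hK₁⟩ : ∃ K₁ : ((Fin (d + 1) → ℤ) → ℝ) → (Fin (d + 1) → ℤ) → ℝ,
      ∀ u x, K₁ u x = ∑ z ∈ S, K x z * ((cutAt hd (ℓ + 1) c.a c.M c.ρ c.k s z - cutAt hd (ℓ + 1) c.a c.M c.ρ c.k s x) * (η ^ 2 * gAxf u z)
        + (cutBt hd (ℓ + 1) c.a c.M c.ρ c.k s z - cutBt hd (ℓ + 1) c.a c.M c.ρ c.k s x) * gBxf u z) := ⟨_, fun _ _ => rfl⟩
  obtain ⟨ψ, hψ⟩ : ∃ ψ : ((Fin (d + 1) → ℤ) → ℝ) → (Fin (d + 1) → ℤ) → ℝ,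
      ∀ u x, ψ u x = if h : x ∈ S then ∑ z : ↥S, T⁻¹ ⟨x, h⟩ z * u z.1 else 0 := ⟨_, fun _ _ => rfl⟩
  -- facts about the explicit objects
  have hgAx_pull : ∀ u (y : ↥(boxDom (N0 ℓ Mh c.k (boxP ℓ c.M c.ρ c.k c.k)))),
      gAxf u (y.1 - shift ℓ Mh c.a c.ρ c.k c.k) = (gml (N0 ℓ Mh c.k (boxP ℓ c.M c.ρ c.k c.k)) ℓ c.k (levD Mh c) aw *ᵥ uAf u) y := by
    intro u y
    have h := dite_shift_apply (shift ℓ Mh c.a c.ρ c.k c.k) (gml (N0 ℓ Mh c.k (boxP ℓ c.M c.ρ c.k c.k)) ℓ c.k (levD Mh c) aw *ᵥ uAf u) y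
    rw [hgAxf]; exact h
  have hgBx_mem : ∀ u (y : ↥(wall hd (ℓ + 1) c.a c.M c.ρ c.k S (4 * s))),
      gBxf u y.1 = (((Matrix.of fun x z : ↥(wall hd (ℓ + 1) c.a c.M c.ρ c.k S (4 * s)) => K x.1 z.1)⁻¹) *ᵥ uBf u) y := by
    intro u y; rw [hgBxf, dif_pos y.2]
  have hgBx0 : ∀ u z, z ∉ wall hd (ℓ + 1) c.a c.M c.ρ c.k S (4 * s) → gBxf u z = 0 := by
    intro u z hz; rw [hgBxf, dif_neg hz]
  have hw0 : ∀ j, 0 ≤ w j := fun j => (hwpos j).le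
  have hcubeS : ∀ j, j ≤ c.k → ∀ z, z ∈ c.sq j → z ∈ S := fun j _ z hz => (hS z).mpr (sq_subset_zero c j hz)
  -- (i) region A at exponent 4: the weighted output `η⁴(L^{lev y})²|G′u_A| ≤ C′N`
  have hregA' : ∀ (f : ↥(boxDom (N0 ℓ Mh c.k (boxP ℓ c.M c.ρ c.k c.k))) → ℝ) (S' : ℝ), 0 ≤ S' →
      (∀ z : ↥(boxDom (N0 ℓ Mh c.k (boxP ℓ c.M c.ρ c.k c.k))), |f z| ≤ S' * ((((ℓ : ℝ) + 1) ^ levD Mh c z.1) ^ 4)⁻¹) →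
      ∀ y : ↥(boxDom (N0 ℓ Mh c.k (boxP ℓ c.M c.ρ c.k c.k))),
        |(gml (N0 ℓ Mh c.k (boxP ℓ c.M c.ρ c.k c.k)) ℓ c.k (levD Mh c) aw *ᵥ f) y| ≤
          C' * (((ℓ : ℝ) + 1) ^ levD Mh c y.1) ^ 2 * ((((ℓ : ℝ) + 1) ^ levD Mh c y.1) ^ 4)⁻¹ * S' := by
    intro f S' hS' hf y
    exact (hregA c.k Mh R hMh hM0 hR2 hRN (boxP ℓ c.M c.ρ c.k c.k) hPbox DL aw cw haw hc hrec f S' hS' hf y).1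
  have hAw : ∀ u N, 0 ≤ N → BW u N → ∀ y : ↥(boxDom (N0 ℓ Mh c.k (boxP ℓ c.M c.ρ c.k c.k))),
      η ^ 4 * (((ℓ : ℝ) + 1) ^ levD Mh c y.1) ^ 2 *
        |(gml (N0 ℓ Mh c.k (boxP ℓ c.M c.ρ c.k c.k)) ℓ c.k (levD Mh c) aw *ᵥ uAf u) y| ≤ C' * N := by
    intro u N hN hu y
    rw [hBW] at hu
    exact regionA_bounds4 c hη aw hregA' hs1 u hN hu (uAf u) (huAf u) y
  -- the unweighted consequence `η²|gAx| ≤ C′Nη⁻²` (levels `≥ 1`)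
  have hAbound : ∀ u N, 0 ≤ N → BW u N → ∀ z, η ^ 2 * |gAxf u z| ≤ C' * N * (η ^ 2)⁻¹ := by
    intro u N hN hu z
    rw [hgAxf]
    split_ifs with h
    · have hb := hAw u N hN hu ⟨_, h⟩
      have hlam : (1 : ℝ) ≤ (((ℓ : ℝ) + 1) ^ levD Mh c (z + shift ℓ Mh c.a c.ρ c.k c.k)) ^ 2 :=
        one_le_pow₀ (one_le_pow₀ (by linarith [(Nat.cast_nonneg ℓ : (0 : ℝ) ≤ ℓ)]))
      rw [le_mul_inv_iff₀ hη2]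
      calc η ^ 2 * |(gml (N0 ℓ Mh c.k (boxP ℓ c.M c.ρ c.k c.k)) ℓ c.k (levD Mh c) aw *ᵥ uAf u) ⟨_, h⟩| * η ^ 2
          = η ^ 4 * 1 * |(gml (N0 ℓ Mh c.k (boxP ℓ c.M c.ρ c.k c.k)) ℓ c.k (levD Mh c) aw *ᵥ uAf u) ⟨_, h⟩| := by ring
        _ ≤ η ^ 4 * (((ℓ : ℝ) + 1) ^ levD Mh c (z + shift ℓ Mh c.a c.ρ c.k c.k)) ^ 2 *
              |(gml (N0 ℓ Mh c.k (boxP ℓ c.M c.ρ c.k c.k)) ℓ c.k (levD Mh c) aw *ᵥ uAf u) ⟨_, h⟩| :=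
            mul_le_mul_of_nonneg_right (mul_le_mul_of_nonneg_left hlam (by positivity)) (abs_nonneg _)
        _ ≤ C' * N := hb
    · rw [abs_zero, mul_zero]; positivity
  -- the weighted consequence at a site of `□_j ∩ □₁`: `(Lʲη)²·η²|gAx(x)| ≤ C′N`
  have hAweighted : ∀ u N, 0 ≤ N → BW u N → ∀ j, j ≤ c.k → ∀ x, x ∈ c.sq j → x ∈ cube (ℓ + 1) c.a c.M c.ρ c.k 1 →
      ((((ℓ + 1 : ℕ) : ℝ)) ^ j * η) ^ 2 * (η ^ 2 * |gAxf u x|) ≤ C' * N := by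
    intro u N hN hu j hj x hxj hx1
    rw [hgAxf]
    split_ifs with h
    · have hb := hAw u N hN hu ⟨_, h⟩
      -- `j ≤ lev (x + t)`
      have hjlev : j ≤ levD Mh c (x + shift ℓ Mh c.a c.ρ c.k c.k) := by
        rcases Nat.eq_zero_or_pos j with hj0 | hjpos
        · rw [hj0]; exact Nat.zero_le _
        · exact (le_levD_iff Mh c hjpos hj (x + shift ℓ Mh c.a c.ρ c.k c.k)).mpr (by rw [add_sub_cancel_right]; exact hxj)
      have hpowle : ((((ℓ + 1 : ℕ) : ℝ)) ^ j) ^ 2 ≤ (((ℓ : ℝ) + 1) ^ levD Mh c (x + shift ℓ Mh c.a c.ρ c.k c.k)) ^ 2 := by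
        rw [hcast]
        exact pow_le_pow_left₀ (by positivity) (pow_le_pow_right₀ (by linarith [(Nat.cast_nonneg ℓ : (0 : ℝ) ≤ ℓ)]) hjlev) 2
      calc ((((ℓ + 1 : ℕ) : ℝ)) ^ j * η) ^ 2 * (η ^ 2 * |(gml (N0 ℓ Mh c.k (boxP ℓ c.M c.ρ c.k c.k)) ℓ c.k (levD Mh c) aw *ᵥ uAf u) ⟨_, h⟩|)
          = η ^ 4 * ((((ℓ + 1 : ℕ) : ℝ)) ^ j) ^ 2 * |(gml (N0 ℓ Mh c.k (boxP ℓ c.M c.ρ c.k c.k)) ℓ c.k (levD Mh c) aw *ᵥ uAf u) ⟨_, h⟩| := by ring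
        _ ≤ η ^ 4 * (((ℓ : ℝ) + 1) ^ levD Mh c (x + shift ℓ Mh c.a c.ρ c.k c.k)) ^ 2 *
              |(gml (N0 ℓ Mh c.k (boxP ℓ c.M c.ρ c.k c.k)) ℓ c.k (levD Mh c) aw *ᵥ uAf u) ⟨_, h⟩| :=
            mul_le_mul_of_nonneg_right (mul_le_mul_of_nonneg_left hpowle (by positivity)) (abs_nonneg _)
        _ ≤ C' * N := hb
    · rw [abs_zero, mul_zero, mul_zero]; positivity
  -- (ii) the wall: `BW u N` gives the `(−2)`-bound with `Nη⁻²`, so `|gBx| ≤ C_W·Nη⁻²`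
  have hBW2 : ∀ u N, 0 ≤ N → BW u N →
      ∀ j, j ≤ c.k → ∀ z, z ∈ c.sq j → ((((ℓ + 1 : ℕ) : ℝ)) ^ j * η) ^ 2 * |u z| ≤ N * (η ^ 2)⁻¹ := by
    intro u N hN hu j hj z hz
    rw [hBW] at hu
    have hb := hu j hj z hz
    have hLj : (1 : ℝ) ≤ (((ℓ + 1 : ℕ) : ℝ)) ^ j := one_le_pow₀ hLr
    rw [le_mul_inv_iff₀ hη2]
    calc ((((ℓ + 1 : ℕ) : ℝ)) ^ j * η) ^ 2 * |u z| * η ^ 2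
        = ((((ℓ + 1 : ℕ) : ℝ)) ^ j * η) ^ 2 * (1 * η) ^ 2 * |u z| := by ring
      _ ≤ ((((ℓ + 1 : ℕ) : ℝ)) ^ j * η) ^ 2 * ((((ℓ + 1 : ℕ) : ℝ)) ^ j * η) ^ 2 * |u z| := by
          refine mul_le_mul_of_nonneg_right (mul_le_mul_of_nonneg_left ?_ (by positivity)) (abs_nonneg _)
          rw [mul_pow, mul_pow, one_pow]
          exact mul_le_mul_of_nonneg_right (one_le_pow₀ hLj) (by positivity)
      _ = ((((ℓ + 1 : ℕ) : ℝ)) ^ j * η) ^ 4 * |u z| := by ring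
      _ ≤ N := hb
  have hBbound : ∀ u N, 0 ≤ N → BW u N → ∀ z, |gBxf u z| ≤ CW * (N * (η ^ 2)⁻¹) := by
    intro u N hN hu z
    rw [hgBxf]
    split_ifs with h
    · have hb := regionB_bound c hη0 w hwpos K hK S hS (a₀ := 4) (by norm_num) (by norm_num)
        (fun j hj => (hwin j hj).1) (fun j hj => (hwin j hj).2) (s := s) (mW := 4 * s) hmWρ u (by positivity) (hBW2 u N hN hu)
        (uBf u) (huBf u) ⟨z, h⟩
      rw [hCW]; exact hb
    · rw [abs_zero]; positivity
  -- (iii) the weighted bound of the parametrix: `(Lʲη)²|P u(x)| ≤ (C′ + L²C_W)N` on `□_j`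
  have hPbound : ∀ u N, 0 ≤ N → BW u N → ∀ j, j ≤ c.k → ∀ x, x ∈ c.sq j →
      ((((ℓ + 1 : ℕ) : ℝ)) ^ j * η) ^ 2 * |Pf u x| ≤ (C' + (((ℓ + 1 : ℕ) : ℝ)) ^ 2 * CW) * N := by
    intro u N hN hu j hj x hxj
    rw [hPf]
    obtain ⟨-, hAt, -, hBt⟩ := cut_mem hd (ℓ + 1) c.a c.M c.ρ c.k s x
    -- term A
    have hA : ((((ℓ + 1 : ℕ) : ℝ)) ^ j * η) ^ 2 * |cutAt hd (ℓ + 1) c.a c.M c.ρ c.k s x * (η ^ 2 * gAxf u x)| ≤ C' * N := by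
      by_cases h0 : cutAt hd (ℓ + 1) c.a c.M c.ρ c.k s x = 0
      · rw [h0, zero_mul, abs_zero, mul_zero]; positivity
      · have hx1 := (B8Eq1101CubeMemberCutoffs.depth_of_cutAt_ne_zero hd (ℓ + 1) c.a c.M c.ρ c.k hs1 hk h0).2.1
        have hb := hAweighted u N hN hu j hj x hxj hx1
        rw [abs_mul, abs_of_nonneg hAt.1, abs_mul, abs_of_nonneg hη2.le]
        calc ((((ℓ + 1 : ℕ) : ℝ)) ^ j * η) ^ 2 * (cutAt hd (ℓ + 1) c.a c.M c.ρ c.k s x * (η ^ 2 * |gAxf u x|))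
            ≤ ((((ℓ + 1 : ℕ) : ℝ)) ^ j * η) ^ 2 * (1 * (η ^ 2 * |gAxf u x|)) :=
              mul_le_mul_of_nonneg_left (mul_le_mul_of_nonneg_right hAt.2 (by positivity)) (by positivity)
          _ = ((((ℓ + 1 : ℕ) : ℝ)) ^ j * η) ^ 2 * (η ^ 2 * |gAxf u x|) := by rw [one_mul]
          _ ≤ C' * N := hb
    -- term B: `h̃_B(x) ≠ 0` forces depth `≤ 4s − 1`, hence `x ∉ □₂` and `j ≤ 1`
    have hB : ((((ℓ + 1 : ℕ) : ℝ)) ^ j * η) ^ 2 * |cutBt hd (ℓ + 1) c.a c.M c.ρ c.k s x * gBxf u x| ≤ (((ℓ + 1 : ℕ) : ℝ)) ^ 2 * CW * N := by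
      by_cases h0 : cutBt hd (ℓ + 1) c.a c.M c.ρ c.k s x = 0
      · rw [h0, zero_mul, abs_zero, mul_zero]; positivity
      · have hdepth := ((cutBt_facts hd (ℓ + 1) c.a c.M c.ρ c.k hs1 x).1 h0).2
        have hj1 : j ≤ 1 := by
          by_contra hj2
          push Not at hj2
          have hx2 : x ∈ cube (ℓ + 1) c.a c.M c.ρ c.k 2 := cube_anti (Nat.succ_le_of_lt hj2) hj (c.sq_subset_cube hj hxj)
          have hge := depth_ge_of_mem_inner hd c.a c.M c.ρ (show 1 < 2 by norm_num) (le_trans (Nat.succ_le_of_lt hj2) hj) hx2 (L := ℓ + 1)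
          simp only [pow_one] at hge
          have hs4z : 4 * (s : ℤ) + (d + 1 : ℕ) * (ℓ : ℤ) ≤ (c.ρ : ℤ) * (ℓ + 1 : ℕ) := by exact_mod_cast hs4
          push_cast at hge hs4z hdepth
          nlinarith
        have hwle : ((((ℓ + 1 : ℕ) : ℝ)) ^ j * η) ^ 2 ≤ (((ℓ + 1 : ℕ) : ℝ)) ^ 2 * η ^ 2 := by
          rw [mul_pow]
          refine mul_le_mul_of_nonneg_right ?_ hη2.le
          rw [← pow_mul]
          exact pow_le_pow_right₀ hLr (by omega)
        have hgb := hBbound u N hN hu x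
        rw [abs_mul, abs_of_nonneg hBt.1]
        calc ((((ℓ + 1 : ℕ) : ℝ)) ^ j * η) ^ 2 * (cutBt hd (ℓ + 1) c.a c.M c.ρ c.k s x * |gBxf u x|)
            ≤ ((((ℓ + 1 : ℕ) : ℝ)) ^ 2 * η ^ 2) * (1 * (CW * (N * (η ^ 2)⁻¹))) :=
              mul_le_mul hwle (mul_le_mul hBt.2 hgb (abs_nonneg _) zero_le_one) (mul_nonneg hBt.1 (abs_nonneg _)) (by positivity)
          _ = (((ℓ + 1 : ℕ) : ℝ)) ^ 2 * CW * N * (η ^ 2 * (η ^ 2)⁻¹) := by ring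
          _ = (((ℓ + 1 : ℕ) : ℝ)) ^ 2 * CW * N := by rw [mul_inv_cancel₀ hη2.ne', mul_one]
    calc ((((ℓ + 1 : ℕ) : ℝ)) ^ j * η) ^ 2 * |cutAt hd (ℓ + 1) c.a c.M c.ρ c.k s x * (η ^ 2 * gAxf u x) + cutBt hd (ℓ + 1) c.a c.M c.ρ c.k s x * gBxf u x|
        ≤ ((((ℓ + 1 : ℕ) : ℝ)) ^ j * η) ^ 2 * (|cutAt hd (ℓ + 1) c.a c.M c.ρ c.k s x * (η ^ 2 * gAxf u x)| + |cutBt hd (ℓ + 1) c.a c.M c.ρ c.k s x * gBxf u x|) :=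
          mul_le_mul_of_nonneg_left (abs_add_le _ _) (by positivity)
      _ ≤ C' * N + (((ℓ + 1 : ℕ) : ℝ)) ^ 2 * CW * N := by rw [mul_add]; exact add_le_add hA hB
      _ = (C' + (((ℓ + 1 : ℕ) : ℝ)) ^ 2 * CW) * N := by ring
  -- (iv) `K₁` halves the `(−4)`-size: zero on `□₂` (§3), small at levels `≤ 1` (F4b `commutator_bound`)
  have hKhalf : ∀ u N, 0 ≤ N → BW u N → BW (K₁ u) (N / 2) := by
    intro u N hN hu
    rw [hBW]
    intro j hj z hz
    have hzS : z ∈ S := hcubeS j hj z hz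
    rcases Nat.lt_or_ge j 2 with hj1 | hj2
    · -- levels `≤ 1`
      have hcb := commutator_bound c hη0 w aw hw0 (by linarith [(haw 1).1]) (haw 1).2 hw K hK S hS hs1 hρs
        (gAxf u) (gBxf u) (A := C' * N * (η ^ 2)⁻¹) (B := CW * (N * (η ^ 2)⁻¹)) (by positivity) (by positivity)
        (hAbound u N hN hu) (hBbound u N hN hu)
        (fun z hz => hgBx0 u z (fun h => hz (wall_subset hd (ℓ + 1) c.a c.M c.ρ c.k S (4 * s) h))) hzS hj hz
      rw [hK₁]
      have hwle : ((((ℓ + 1 : ℕ) : ℝ)) ^ j * η) ^ 2 ≤ (((ℓ + 1 : ℕ) : ℝ)) ^ 2 * η ^ 2 := by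
        rw [mul_pow]
        refine mul_le_mul_of_nonneg_right ?_ hη2.le
        rw [← pow_mul]
        exact pow_le_pow_right₀ hLr (by omega)
      have hsplit : ∀ y : ℝ, ((((ℓ + 1 : ℕ) : ℝ)) ^ j * η) ^ 4 * |y| = ((((ℓ + 1 : ℕ) : ℝ)) ^ j * η) ^ 2 * (((((ℓ + 1 : ℕ) : ℝ)) ^ j * η) ^ 2 * |y|) := by
        intro y; ring
      rw [hsplit]
      calc ((((ℓ + 1 : ℕ) : ℝ)) ^ j * η) ^ 2 * (((((ℓ + 1 : ℕ) : ℝ)) ^ j * η) ^ 2 *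
            |∑ z' ∈ S, K z z' * ((cutAt hd (ℓ + 1) c.a c.M c.ρ c.k s z' - cutAt hd (ℓ + 1) c.a c.M c.ρ c.k s z) * (η ^ 2 * gAxf u z')
              + (cutBt hd (ℓ + 1) c.a c.M c.ρ c.k s z' - cutBt hd (ℓ + 1) c.a c.M c.ρ c.k s z) * gBxf u z')|)
          ≤ ((((ℓ + 1 : ℕ) : ℝ)) ^ 2 * η ^ 2) * (10 * ((d : ℝ) + 1) * (((ℓ + 1 : ℕ) : ℝ)) ^ 2 * (C' * N * (η ^ 2)⁻¹ + CW * (N * (η ^ 2)⁻¹)) / s) :=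
            mul_le_mul hwle hcb (by positivity) (by positivity)
        _ = 10 * ((d : ℝ) + 1) * (((ℓ + 1 : ℕ) : ℝ)) ^ 4 * (C' + CW) * N / s * (η ^ 2 * (η ^ 2)⁻¹) := by ring
        _ = 10 * ((d : ℝ) + 1) * (((ℓ + 1 : ℕ) : ℝ)) ^ 4 * (C' + CW) * N / s := by rw [mul_inv_cancel₀ hη2.ne', mul_one]
        _ ≤ N / 2 := by
            rw [div_le_iff₀ hs0r]
            have : 10 * ((d : ℝ) + 1) * (((ℓ + 1 : ℕ) : ℝ)) ^ 4 * (C' + CW) * N = (s₀ / 2) * N := by rw [hs₀]; ring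
            rw [this]
            have hN2 : 0 ≤ N / 2 := by positivity
            nlinarith
    · -- levels `≥ 2`: the row vanishes
      have hk2 : 2 ≤ c.k := hj2.trans hj
      have hz2 : z ∈ cube (ℓ + 1) c.a c.M c.ρ c.k 2 := cube_anti hj2 hj (c.sq_subset_cube hj hz)
      rw [hK₁, commutator_vanish_deep c hk2 w K hK S hs1 hs4 (gAxf u) (gBxf u) hz2, abs_zero, mul_zero]
      positivity
  -- (v) the identity `ψ u x = P u x − ψ (K₁u) x` on `S`, from `T·P = 1 + K₁` and `T⁻¹T = 1`
  have hTunit : IsUnit T := by rw [hT]; exact isUnit_flatMatrix hd hη0 (ℓ + 1) c.k c.lamS w hw0 K hK S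
  have hTT : T⁻¹ * T = 1 := Matrix.nonsing_inv_mul T ((Matrix.isUnit_iff_isUnit_det T).mp hTunit)
  have hident : ∀ u (x : ↥S), ψ u x.1 = Pf u x.1 - ψ (K₁ u) x.1 := by
    intro u x
    have hrow : ∀ z : ↥S, ∑ y : ↥S, T z y * Pf u y.1 = u z.1 + K₁ u z.1 := by
      intro z
      have hpi := parametrix_identity hℓ hMh2 c DL hlevDL hη0 w aw hw0 hawpos hw K hK S hS hs1 (mW := 4 * s) le_rfl u
        (uAf u) (huAf u) (gAxf u) (hgAx_pull u) (uBf u) (huBf u) (gBxf u) (hgBx_mem u) (hgBx0 u) z.2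
      rw [hK₁, ← hpi, ← Finset.sum_coe_sort S]
      refine Finset.sum_congr rfl fun y _ => ?_
      rw [hT, Matrix.of_apply, hPf]
    have h1 : ∑ z : ↥S, T⁻¹ x z * (u z.1 + K₁ u z.1) = Pf u x.1 := by
      calc ∑ z : ↥S, T⁻¹ x z * (u z.1 + K₁ u z.1)
          = ∑ z : ↥S, T⁻¹ x z * ∑ y : ↥S, T z y * Pf u y.1 := Finset.sum_congr rfl fun z _ => by rw [hrow z]
        _ = ∑ y : ↥S, (∑ z : ↥S, T⁻¹ x z * T z y) * Pf u y.1 := by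
            simp_rw [Finset.mul_sum]
            rw [Finset.sum_comm]
            refine Finset.sum_congr rfl fun y _ => ?_
            rw [Finset.sum_mul]
            refine Finset.sum_congr rfl fun z _ => ?_
            ring
        _ = ∑ y : ↥S, (T⁻¹ * T) x y * Pf u y.1 := Finset.sum_congr rfl fun y _ => by rw [Matrix.mul_apply]
        _ = Pf u x.1 := by
            rw [hTT]
            simp_rw [Matrix.one_apply, ite_mul, one_mul, zero_mul]
            rw [Finset.sum_ite_eq]; simp
    have hψx : ψ u x.1 = ∑ z : ↥S, T⁻¹ x z * u z.1 := by rw [hψ, dif_pos x.2]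
    have hψK : ψ (K₁ u) x.1 = ∑ z : ↥S, T⁻¹ x z * K₁ u z.1 := by rw [hψ, dif_pos x.2]
    rw [hψx, hψK, ← h1, ← Finset.sum_sub_distrib]
    refine Finset.sum_congr rfl fun z _ => ?_
    ring
  -- (vi) the crude bound (the level-0 reading `|u| ≤ Nη⁻⁴`)
  have hcrude : ∀ (x : ↥S) u N, 0 ≤ N → BW u N → |ψ u x.1| ≤ ((η ^ 4)⁻¹ * ∑ z : ↥S, |T⁻¹ x z|) * N := by
    intro x u N hN hu
    rw [hBW] at hu
    rw [hψ, dif_pos x.2, Finset.mul_sum, Finset.sum_mul]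
    refine (Finset.abs_sum_le_sum_abs _ _).trans (Finset.sum_le_sum fun z _ => ?_)
    rw [abs_mul]
    have hz0 : z.1 ∈ c.sq 0 := (hS z.1).mp z.2
    have hb := hu 0 (Nat.zero_le _) z.1 hz0
    rw [pow_zero, one_mul] at hb
    have hη4 : 0 < η ^ 4 := by positivity
    have : |u z.1| ≤ (η ^ 4)⁻¹ * N := by rw [le_inv_mul_iff₀ hη4]; exact hb
    calc |T⁻¹ x z| * |u z.1| ≤ |T⁻¹ x z| * ((η ^ 4)⁻¹ * N) := mul_le_mul_of_nonneg_left this (abs_nonneg _)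
      _ = (η ^ 4)⁻¹ * |T⁻¹ x z| * N := by ring
  -- (vii) the source `u₁` extended by zero, of size `r`
  obtain ⟨u₀, hu₀⟩ : ∃ u₀ : (Fin (d + 1) → ℤ) → ℝ, ∀ z, u₀ z = if h : z ∈ S then u₁ ⟨z, h⟩ else 0 := ⟨_, fun _ => rfl⟩
  have hBWu₀ : BW u₀ r := by
    rw [hBW]
    intro j hj z hz
    have hzS : z ∈ S := hcubeS j hj z hz
    rw [hu₀, dif_pos hzS]
    have h := hu₁ j hj ⟨z, hzS⟩ hz
    simpa [wt] using h
  -- conclusion at `v ∈ □_{j₀}`: the a-priori bound for the weighted functional `u ↦ (L^{j₀}η)²ψ u v`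
  have hvc : v.1 ∈ c.sq j₀ := hv
  have hmain := apriori_functional_bound BW K₁ (fun u => ((((ℓ + 1 : ℕ) : ℝ)) ^ j₀ * η) ^ 2 * ψ u v.1)
    (fun u => ((((ℓ + 1 : ℕ) : ℝ)) ^ j₀ * η) ^ 2 * Pf u v.1) (C := C' + (((ℓ + 1 : ℕ) : ℝ)) ^ 2 * CW)
    (B₀ := ((((ℓ + 1 : ℕ) : ℝ)) ^ j₀ * η) ^ 2 * ((η ^ 4)⁻¹ * ∑ z : ↥S, |T⁻¹ v z|)) (by positivity)
    (fun u => by rw [hident u v]; ring)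
    (fun u N hN hu => by rw [abs_mul, abs_of_nonneg (by positivity)]; exact hPbound u N hN hu j₀ hj₀ v.1 hvc)
    hKhalf
    (fun u N hN hu => by
      rw [abs_mul, abs_of_nonneg (by positivity), mul_assoc]
      exact mul_le_mul_of_nonneg_left (hcrude v u N hN hu) (by positivity))
    u₀ hr hBWu₀
  have hφψ : ∑ z : ↥S, T⁻¹ v z * u₁ z = ψ u₀ v.1 := by
    rw [hψ, dif_pos v.2]
    refine Finset.sum_congr rfl fun z _ => ?_
    rw [hu₀, dif_pos z.2]
  rw [hφψ]
  have hwt : wt (ℓ + 1) η j₀ ^ 2 = ((((ℓ + 1 : ℕ) : ℝ)) ^ j₀ * η) ^ 2 := by simp [wt]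
  rw [hwt, ← abs_of_nonneg (by positivity : (0 : ℝ) ≤ ((((ℓ + 1 : ℕ) : ℝ)) ^ j₀ * η) ^ 2), ← abs_mul]
  simpa [mul_assoc] using hmain

end Literature.MathematicalPhysics.QuantumFieldTheory.Balaban1983to89.B8Eq1101DentedCubeMemberRealM4
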